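import Summits.Parity.GeneralizedHardyLittlewood.Theorems.BeyondDiagonalBeatsQuarter.KernelFormXSqTools
import HarnessLib

/-!
# The second logarithmic Riesz mean of `(μ ∗ μ)(k)/k`:
# `R⁽²⁾(z) = Σ_{de ≤ z} μ(d)μ(e)/(de)·log²(z/(de)) = 2 + O(1/log² z)`

Supports stmt-Parity-20343 (`PrimeLevelFamEdge.BeyondDiagonalBeatsQuarter`, K_B; line
`diagonal_kernel_split`, registered stub `stub_kernelFormXSq` — the q-free kernel asymptotics of the KMV
second mollified moment at the profile `X²`). A helper; it closes nothing. Namespace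
`Summit.Parity.GeneralizedHardyLittlewood.Theorems.BeyondDiagonalBeatsQuarter.KernelFormXSq`. Everything here is PROVED.

The Dirichlet series `1/ζ(1+s)²` vanishes to order two at `s = 0`, so the natural «main-term
carrying» average of its coefficients `(μ ∗ μ)(k)/k` is the SECOND logarithmic Riesz mean
`R⁽²⁾(z) = Σ_{k ≤ z} (μ ∗ μ)(k) k⁻¹ log²(z/k) = Σ_{d ≤ z} μ(d)d⁻¹·R₂(z/d)`, `R₂ = moebiusRiesz 2`
(`= 2·res_{s=0} z^s s⁻³ ζ(1+s)⁻² = 2`). We prove, from the tree's prime number theorem for `μ`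
with de la Vallée-Poussin remainder (`abs_sum_moebius_div_le_exp_neg_sqrt_log`: `Σ_{n≤x} μ(n)/n ≪
e^{−c√log x}`; `abs_sum_moebius_mul_log_div_add_one_le`) and the Riesz-mean bounds of
`KMVMollifierDiagonalMainTerm` (`abs_moebiusRiesz_sub_le`):

* `abs_moebiusSqRiesz_sub_two_le` — `|R⁽²⁾(z) − 2| ≤ C/(1 + log z)²` for all `z ≥ 1`.

Proof (Dirichlet's hyperbola method at `√z`, then Abel summation on the tail):
`R⁽²⁾(z) = Σ_{d,e ≤ √z} + 2Σ_{d ≤ √z < e ≤ z/d}`; the box is `2R₀(√z)R₂(√z) + 2R₁(√z)²` with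
`R₀ ≪ log⁻⁶`, `R₁ = 1 + O(log⁻⁵)`, `R₂ ≪ log`; on the tail the weight `log²(z/(de))` is monotone in
`e`, so partial summation against `Σ_{k≤e} μ(k)/k ≪ (1 + log e)⁻⁶` (`e > √z`) costs `≪ log⁻³ z` per `d`.
This is the `1/ζ²`-input of the q-free kernel asymptotics of the KMV second mollified moment at the
profile `X²` (`KernelFormXSqCore`). Theorems only (no definitions, no named facts); the tools are in
`KernelFormXSqTools`.

## References
* H. L. Montgomery, R. C. Vaughan, *Multiplicative Number Theory I*, CUP 2007, §6.2 (Thm. 6.9) and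
  §8.1 (8.6)–(8.8) (the `μ`-inputs); §2.1 (hyperbola method). [cite: MontgomeryVaughan2007, §8.1]
* E. Kowalski, P. Michel, J. VanderKam, J. reine angew. Math. 526 (2000), Prop. 5.1 p. 18 (the
  residue this file computes in real variables). [cite: KowalskiMichelVanderKam2000, Prop. 5.1]
«The programme SEARCHES and TYPES; no claim about Landau–Siegel zeros, Theorems 1–2 of
arXiv:2211.02515 or a repaired Margin232 until a kernel theorem says so.»
-/

noncomputable section

open scoped Real ArithmeticFunction.Moebius
open Finset ArithmeticFunction

namespace Summit.Parity.GeneralizedHardyLittlewood.Theorems.BeyondDiagonalBeatsQuarter.KernelFormXSq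

open Literature.NumberTheory.LFunctions Literature.NumberTheory.LFunctions.KMV2000

open MollifierMainTerm (moebiusRiesz abs_moebiusRiesz_sub_le)
open Literature.Barriers.Parity (Icc_one_eq_Ioc_zero)

/-! ### The second logarithmic Riesz mean of `(μ ∗ μ)/id` -/

/-- Unfolding `R⁽²⁾` as a sum over the hyperbola `de ≤ ⌊z⌋`:
`R⁽²⁾(z) = Σ_{d ≤ ⌊z⌋} Σ_{e ≤ ⌊z⌋/d} μ(d)μ(e)(de)⁻¹ log²(z/(de))`. [folklore] -/
theorem moebiusSqRiesz_eq_sum (z : ℝ) :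
    ∑ d ∈ Icc 1 ⌊z⌋₊, (μ d : ℝ) / d * moebiusRiesz 2 (z / d) =
      ∑ d ∈ Ioc 0 ⌊z⌋₊, ∑ e ∈ Ioc 0 (⌊z⌋₊ / d),
        (μ d : ℝ) / d * ((μ e : ℝ) / e) * Real.log (z / (d * e)) ^ 2 := by
  unfold moebiusRiesz
  rw [Icc_one_eq_Ioc_zero]
  refine Finset.sum_congr rfl fun d _ ↦ ?_
  rw [Nat.floor_div_natCast, Icc_one_eq_Ioc_zero, Finset.mul_sum]
  refine Finset.sum_congr rfl fun e _ ↦ ?_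
  rw [div_div]
  ring

/-- The hyperbola parameters of `z ≥ 1`: with `u = ⌊√z⌋`, `Z = ⌊z⌋` one has `u ≥ 1`,
`u² ≤ Z < (u+1)²`. [folklore] -/
theorem floor_sqrt_facts {z : ℝ} (hz : 1 ≤ z) :
    1 ≤ ⌊Real.sqrt z⌋₊ ∧ ⌊Real.sqrt z⌋₊ * ⌊Real.sqrt z⌋₊ ≤ ⌊z⌋₊ ∧
      ⌊z⌋₊ < (⌊Real.sqrt z⌋₊ + 1) * (⌊Real.sqrt z⌋₊ + 1) := by
  have hz0 : 0 < z := by linarith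
  set s : ℝ := Real.sqrt z with hsdef
  have hss : s * s = z := Real.mul_self_sqrt hz0.le
  have hs0 : 0 < s := Real.sqrt_pos.2 hz0
  have hs1 : 1 ≤ s := by rw [hsdef, Real.le_sqrt zero_le_one hz0.le]; simpa using hz
  have hus : (⌊s⌋₊ : ℝ) ≤ s := Nat.floor_le hs0.le
  have hsu : s < ⌊s⌋₊ + 1 := Nat.lt_floor_add_one s
  have hu0 : (0 : ℝ) ≤ ⌊s⌋₊ := Nat.cast_nonneg _
  refine ⟨Nat.le_floor (by simpa using hs1), Nat.le_floor ?_, (Nat.floor_lt hz0.le).2 ?_⟩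
  · push_cast; rw [← hss]; exact mul_le_mul hus hus hu0 hs0.le
  · push_cast; rw [← hss]; exact mul_lt_mul'' hsu hsu hs0.le hs0.le

/-- **The tail of the hyperbola.** With `u = ⌊√z⌋`, `Z = ⌊z⌋`:
`|Σ_{d ≤ u} Σ_{u < e ≤ Z/d} μ(d)μ(e)(de)⁻¹ log²(z/(de))| ≤ C/(1 + log z)³` for `z ≥ 1` (Abel summation in
`e` against `Σ_{k≤e} μ(k)/k ≪ (1 + log e)⁻⁶`, the weight `log²(z/(de))` being antitone on `e ≤ z/d`).
[cite: MontgomeryVaughan2007, §8.1 (8.6) — derivation (tail of the hyperbola for 1/ζ²)] -/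
theorem abs_hyperbola_tail_le :
    ∃ C : ℝ, 0 < C ∧ ∀ z : ℝ, 1 ≤ z →
      |∑ d ∈ Ioc 0 ⌊Real.sqrt z⌋₊, ∑ e ∈ Ioc ⌊Real.sqrt z⌋₊ (⌊z⌋₊ / d),
          (μ d : ℝ) / d * ((μ e : ℝ) / e) * Real.log (z / (d * e)) ^ 2| ≤
        C / (1 + Real.log z) ^ 3 := by
  obtain ⟨C₀, hC₀, h0⟩ := abs_sum_moebius_div_le_inv_log_pow
  refine ⟨4 * (C₀ * 4 ^ 6), by positivity, fun z hz ↦ ?_⟩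
  -- notation and basic facts
  have hz0 : 0 < z := by linarith
  set L : ℝ := Real.log z with hLdef
  have hL : 0 ≤ L := Real.log_nonneg hz
  obtain ⟨hu1, huu, hZu⟩ := floor_sqrt_facts hz
  set u : ℕ := ⌊Real.sqrt z⌋₊ with hudef
  set Z : ℕ := ⌊z⌋₊ with hZdef
  have hZz : (Z : ℝ) ≤ z := Nat.floor_le hz0.le
  have hu0 : (0 : ℝ) < u := by exact_mod_cast hu1
  have hu1' : (1 : ℝ) ≤ u := by exact_mod_cast hu1
  have huuz : (u : ℝ) * u ≤ z := by
    have : ((u * u : ℕ) : ℝ) ≤ Z := by exact_mod_cast huu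
    push_cast at this; linarith
  have huz : (u : ℝ) ≤ z := by nlinarith
  have hlogu : (1 + L) / 4 ≤ 1 + Real.log (u : ℝ) := one_add_log_le_floor_sqrt hz
  have hloguL : Real.log (u : ℝ) ≤ L := Real.log_le_log hu0 huz
  -- the uniform bound on `m₀(e)` for `e ≥ u`
  set η : ℝ := C₀ * 4 ^ 6 / (1 + L) ^ 6 with hηdef
  have hη0 : 0 ≤ η := by positivity
  have hm0 : ∀ e : ℕ, u ≤ e → |∑ k ∈ Icc 1 e, (μ k : ℝ) / k| ≤ η := by
    intro e hue
    have he1 : 1 ≤ e := hu1.trans hue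
    have hle : 1 + Real.log (u : ℝ) ≤ 1 + Real.log (e : ℝ) := by
      have := Real.log_le_log hu0 (show (u : ℝ) ≤ e by exact_mod_cast hue); linarith
    calc |∑ k ∈ Icc 1 e, (μ k : ℝ) / k| ≤ C₀ / (1 + Real.log (e : ℝ)) ^ 6 := h0 e he1
      _ ≤ C₀ / ((1 + L) / 4) ^ 6 := by
          apply div_le_div_of_nonneg_left hC₀.le (by positivity)
          exact pow_le_pow_left₀ (by positivity) (hlogu.trans hle) 6
      _ = η := by rw [hηdef]; field_simp
  set g : ℕ → ℝ := fun n ↦ (μ n : ℝ) / n with hgdef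
  have hgle : ∀ n : ℕ, |g n| ≤ (n : ℝ)⁻¹ := by
    intro n
    rcases Nat.eq_zero_or_pos n with rfl | hn
    · simp [hgdef]
    · rw [hgdef]; dsimp only
      rw [abs_div, abs_of_pos (by exact_mod_cast hn : (0 : ℝ) < n), div_eq_mul_inv]
      have : |(μ n : ℝ)| ≤ 1 := by exact_mod_cast ArithmeticFunction.abs_moebius_le_one
      exact mul_le_of_le_one_left (by positivity) this
  set φ : ℕ → ℕ → ℝ := fun d e ↦ Real.log (z / (d * e)) ^ 2 with hφdef
  have hφle : ∀ q : ℝ, 1 ≤ q → q ≤ 2 * z → Real.log (z / q) ^ 2 ≤ (1 + L) ^ 2 := by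
    intro q hq1 hq2
    rw [← sq_abs]
    exact pow_le_pow_left₀ (abs_nonneg _) (abs_log_div_le hz hq1 hq2) 2
  -- the tail, term by term in `d`
  have htail : ∀ d ∈ Ioc 0 u,
      |∑ e ∈ Ioc u (Z / d), g d * g e * φ d e| ≤ (d : ℝ)⁻¹ * (4 * η * (1 + L) ^ 2) := by
    intro d hd
    have hd' := Finset.mem_Ioc.1 hd
    have hd0 : (0 : ℝ) < d := by exact_mod_cast hd'.1
    have hd1 : (1 : ℝ) ≤ d := by exact_mod_cast hd'.1
    have hdu : (d : ℝ) ≤ u := by exact_mod_cast hd'.2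
    have huZd : u ≤ Z / d :=
      (Nat.le_div_iff_mul_le hd'.1).2 (le_trans (Nat.mul_le_mul_left u hd'.2) huu)
    have hsplit : ∑ e ∈ Ioc u (Z / d), g d * g e * φ d e = g d * ∑ e ∈ Ioc u (Z / d), g e * φ d e := by
      rw [Finset.mul_sum]
      exact Finset.sum_congr rfl fun e _ ↦ by ring
    have hinner : |∑ e ∈ Ioc u (Z / d), g e * φ d e| ≤
        η * (2 * φ d (u + 1) + 2 * φ d (Z / d + 1)) := by
      refine abs_sum_Ioc_mul_le_of_antitone g (φ d) huZd (fun e hue _ ↦ hm0 e hue)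
        (fun e ↦ sq_nonneg _) ?_
      intro e hue he1
      simp only [hφdef]
      have he0 : (0 : ℝ) < e := by exact_mod_cast (lt_of_le_of_lt (Nat.zero_le u) hue)
      have hde : ((d : ℝ) * (e + 1 : ℕ)) ≤ z := by
        have h1 : d * (e + 1) ≤ Z := le_trans (Nat.mul_le_mul_left d he1) (Nat.mul_div_le Z d)
        calc ((d : ℝ) * (e + 1 : ℕ)) = ((d * (e + 1) : ℕ) : ℝ) := by push_cast; ring
          _ ≤ Z := by exact_mod_cast h1
          _ ≤ z := hZz
      have hpos : 0 < (d : ℝ) * (e + 1 : ℕ) := by positivity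
      have hlo : 0 ≤ Real.log (z / ((d : ℝ) * (e + 1 : ℕ))) :=
        Real.log_nonneg ((one_le_div hpos).2 hde)
      have hmono : Real.log (z / ((d : ℝ) * (e + 1 : ℕ))) ≤ Real.log (z / ((d : ℝ) * e)) := by
        apply Real.log_le_log (div_pos hz0 hpos)
        apply div_le_div_of_nonneg_left hz0.le (by positivity)
        push_cast; nlinarith
      exact pow_le_pow_left₀ hlo hmono 2
    have hφ1 : φ d (u + 1) ≤ (1 + L) ^ 2 := by
      simp only [hφdef]
      have hq : ((d : ℝ) * ((u + 1 : ℕ) : ℝ)) = (d : ℝ) * ((u : ℝ) + 1) := by push_cast; ring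
      rw [hq]
      refine hφle _ (one_le_mul_of_one_le_of_one_le hd1 (by linarith)) ?_
      calc (d : ℝ) * ((u : ℝ) + 1) ≤ (u : ℝ) * ((u : ℝ) + 1) := by gcongr
        _ = (u : ℝ) * u + u := by ring
        _ ≤ (u : ℝ) * u + (u : ℝ) * u := by nlinarith
        _ ≤ 2 * z := by linarith
    have hφ2 : φ d (Z / d + 1) ≤ (1 + L) ^ 2 := by
      simp only [hφdef]
      set w : ℕ := Z / d with hw
      have hdw : (d : ℝ) * (w : ℝ) ≤ (Z : ℝ) := by exact_mod_cast Nat.mul_div_le Z d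
      have hq : ((d : ℝ) * ((w + 1 : ℕ) : ℝ)) = (d : ℝ) * w + d := by push_cast; ring
      rw [hq]
      refine hφle _ ?_ ?_
      · have : (0 : ℝ) ≤ (d : ℝ) * w := by positivity
        linarith
      · linarith
    rw [hsplit, abs_mul]
    refine mul_le_mul (hgle d) (hinner.trans ?_) (abs_nonneg _) (by positivity)
    calc η * (2 * φ d (u + 1) + 2 * φ d (Z / d + 1)) ≤ η * (2 * (1 + L) ^ 2 + 2 * (1 + L) ^ 2) :=
          mul_le_mul_of_nonneg_left (by linarith [hφ1, hφ2]) hη0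
      _ = 4 * η * (1 + L) ^ 2 := by ring
  have hharm : ∑ d ∈ Icc 1 u, ((d : ℝ))⁻¹ ≤ 1 + Real.log u := by
    have h := harmonic_le_one_add_log u
    simpa [harmonic_eq_sum_Icc, Rat.cast_sum, Rat.cast_inv, Rat.cast_natCast] using h
  refine (Finset.abs_sum_le_sum_abs _ _).trans ((Finset.sum_le_sum htail).trans ?_)
  rw [← Finset.sum_mul, ← Icc_one_eq_Ioc_zero]
  calc (∑ d ∈ Icc 1 u, (d : ℝ)⁻¹) * (4 * η * (1 + L) ^ 2)
      ≤ (1 + Real.log (u : ℝ)) * (4 * η * (1 + L) ^ 2) :=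
        mul_le_mul_of_nonneg_right hharm (by positivity)
    _ ≤ (1 + L) * (4 * η * (1 + L) ^ 2) := by gcongr
    _ = 4 * (C₀ * 4 ^ 6) / (1 + L) ^ 3 := by
        rw [hηdef]; field_simp

/-- **The box of the hyperbola.** With `u = ⌊√z⌋` (`z > 0`):
`Σ_{d,e ≤ u} μ(d)μ(e)(de)⁻¹ log²(z/(de)) = 2R₀(√z)R₂(√z) + 2R₁(√z)²` (`log(z/(de)) = log(√z/d) + log(√z/e)`).
[cite: MontgomeryVaughan2007, §8.1 (8.6)–(8.8) — derivation (box of the hyperbola for 1/ζ²)] -/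
theorem hyperbola_box_eq {z : ℝ} (hz : 0 < z) :
    ∑ d ∈ Ioc 0 ⌊Real.sqrt z⌋₊, ∑ e ∈ Ioc 0 ⌊Real.sqrt z⌋₊,
        (μ d : ℝ) / d * ((μ e : ℝ) / e) * Real.log (z / (d * e)) ^ 2 =
      2 * (moebiusRiesz 0 (Real.sqrt z) * moebiusRiesz 2 (Real.sqrt z)) +
        2 * moebiusRiesz 1 (Real.sqrt z) ^ 2 := by
  set s : ℝ := Real.sqrt z with hsdef
  have hss : s * s = z := Real.mul_self_sqrt hz.le
  have hs0 : 0 < s := Real.sqrt_pos.2 hz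
  set u : ℕ := ⌊s⌋₊ with hudef
  set g : ℕ → ℝ := fun n ↦ (μ n : ℝ) / n with hgdef
  set a : ℕ → ℝ := fun n ↦ Real.log (s / n) with hadef
  have hRj : ∀ j : ℕ, moebiusRiesz j s = ∑ d ∈ Ioc 0 u, g d * a d ^ j := by
    intro j; unfold moebiusRiesz; rw [Icc_one_eq_Ioc_zero]
  have hφa : ∀ d ∈ Ioc 0 u, ∀ e ∈ Ioc 0 u, Real.log (z / (d * e)) ^ 2 = (a d + a e) ^ 2 := by
    intro d hd e he
    have hd0 : (0 : ℝ) < d := by exact_mod_cast (Finset.mem_Ioc.1 hd).1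
    have he0 : (0 : ℝ) < e := by exact_mod_cast (Finset.mem_Ioc.1 he).1
    simp only [hadef]
    congr 1
    rw [Real.log_div hz.ne' (by positivity), Real.log_mul hd0.ne' he0.ne',
      Real.log_div hs0.ne' hd0.ne', Real.log_div hs0.ne' he0.ne', ← hss,
      Real.log_mul hs0.ne' hs0.ne']
    ring
  rw [hRj 0, hRj 1, hRj 2]
  have hexp : ∀ d ∈ Ioc 0 u, ∀ e ∈ Ioc 0 u,
      (μ d : ℝ) / d * ((μ e : ℝ) / e) * Real.log (z / (d * e)) ^ 2 =
      (g d * a d ^ 2) * (g e * a e ^ 0) + (g d * a d ^ 0) * (g e * a e ^ 2) +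
        2 * ((g d * a d ^ 1) * (g e * a e ^ 1)) := by
    intro d hd e he
    rw [hφa d hd e he]
    simp only [hgdef]
    ring
  rw [Finset.sum_congr rfl fun d hd ↦ Finset.sum_congr rfl fun e he ↦ hexp d hd e he]
  simp only [Finset.sum_add_distrib, ← Finset.mul_sum, ← Finset.sum_mul, sq]
  ring

/-- **The box is `2 + O(log⁻⁵ z)`:** `|2R₀(√z)R₂(√z) + 2R₁(√z)² − 2| ≤ C/(1 + log z)²` for `z ≥ 1`
(`R₀ ≪ log⁻⁶`, `R₂ ≪ log`, `R₁ = 1 + O(log⁻⁵)`).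
[cite: MontgomeryVaughan2007, §8.1 (8.6)–(8.8) — derivation] -/
theorem abs_hyperbola_box_sub_two_le :
    ∃ C : ℝ, 0 < C ∧ ∀ z : ℝ, 1 ≤ z →
      |2 * (moebiusRiesz 0 (Real.sqrt z) * moebiusRiesz 2 (Real.sqrt z)) +
          2 * moebiusRiesz 1 (Real.sqrt z) ^ 2 - 2| ≤ C / (1 + Real.log z) ^ 2 := by
  obtain ⟨C₀, hC₀, h0⟩ := abs_sum_moebius_div_le_inv_log_pow
  obtain ⟨C₁, hC₁, h1⟩ := abs_moebiusRiesz_one_sub_one_le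
  obtain ⟨A, hA, h2⟩ := abs_moebiusRiesz_two_le
  set η₀ : ℝ := C₀ * 4 ^ 6 with hη₀
  refine ⟨2 * η₀ * (1 + A) + 64 * C₁ * (2 + 32 * C₁), by positivity, fun z hz ↦ ?_⟩
  have hz0 : 0 < z := by linarith
  set L : ℝ := Real.log z with hLdef
  have hL : 0 ≤ L := Real.log_nonneg hz
  set s : ℝ := Real.sqrt z with hsdef
  have hs0 : 0 < s := Real.sqrt_pos.2 hz0
  have hs1 : 1 ≤ s := by rw [hsdef, Real.le_sqrt zero_le_one hz0.le]; simpa using hz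
  have hlogs : Real.log s = L / 2 := by rw [hsdef, Real.log_sqrt hz0.le]
  obtain ⟨hu1, -, -⟩ := floor_sqrt_facts hz
  set u : ℕ := ⌊s⌋₊ with hudef
  have hlogu : (1 + L) / 4 ≤ 1 + Real.log (u : ℝ) := one_add_log_le_floor_sqrt hz
  -- the three Riesz means at `√z`
  set η : ℝ := η₀ / (1 + L) ^ 6 with hηdef
  have hη0 : 0 ≤ η := by positivity
  have hR0 : |moebiusRiesz 0 s| ≤ η := by
    have e : moebiusRiesz 0 s = ∑ k ∈ Icc 1 u, (μ k : ℝ) / k := by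
      simp only [moebiusRiesz, pow_zero, mul_one, hudef]
    rw [e]
    calc |∑ k ∈ Icc 1 u, (μ k : ℝ) / k| ≤ C₀ / (1 + Real.log (u : ℝ)) ^ 6 := h0 u hu1
      _ ≤ C₀ / ((1 + L) / 4) ^ 6 := by
          apply div_le_div_of_nonneg_left hC₀.le (by positivity)
          exact pow_le_pow_left₀ (by positivity) hlogu 6
      _ = η := by rw [hηdef, hη₀]; field_simp
  have hR2 : |moebiusRiesz 2 s| ≤ (1 + A) * (1 + L) := by
    refine (h2 s hs1).trans ?_
    rw [hlogs]
    have : 0 ≤ A * L := mul_nonneg hA.le hL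
    linarith
  have hR1 : |moebiusRiesz 1 s - 1| ≤ 32 * C₁ / (1 + L) ^ 5 := by
    refine (h1 s hs1).trans ?_
    rw [hlogs, div_le_div_iff₀ (by positivity) (by positivity)]
    have : (1 + L) ^ 5 ≤ 32 * (1 + L / 2) ^ 5 := by
      rw [show (32 : ℝ) * (1 + L / 2) ^ 5 = (2 * (1 + L / 2)) ^ 5 by ring]
      exact pow_le_pow_left₀ (by positivity) (by linarith) 5
    calc C₁ * (1 + L) ^ 5 ≤ C₁ * (32 * (1 + L / 2) ^ 5) := mul_le_mul_of_nonneg_left this hC₁.le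
      _ = 32 * C₁ * (1 + L / 2) ^ 5 := by ring
  have hR1' : |moebiusRiesz 1 s - 1| ≤ 32 * C₁ :=
    hR1.trans (div_le_self (by positivity) (one_le_pow₀ (by linarith)))
  have hR1sq : |moebiusRiesz 1 s ^ 2 - 1| ≤ 32 * C₁ / (1 + L) ^ 5 * (2 + 32 * C₁) := by
    rw [show moebiusRiesz 1 s ^ 2 - 1 = (moebiusRiesz 1 s - 1) * (moebiusRiesz 1 s + 1) by ring,
      abs_mul]
    refine mul_le_mul hR1 ?_ (abs_nonneg _) (by positivity)
    calc |moebiusRiesz 1 s + 1| = |(moebiusRiesz 1 s - 1) + 2| := by ring_nf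
      _ ≤ |moebiusRiesz 1 s - 1| + |2| := abs_add_le _ _
      _ ≤ 32 * C₁ + 2 := by rw [abs_two]; linarith [hR1']
      _ = 2 + 32 * C₁ := by ring
  have hA1 : |2 * (moebiusRiesz 0 s * moebiusRiesz 2 s)| ≤ 2 * (η * ((1 + A) * (1 + L))) := by
    rw [abs_mul, abs_two, abs_mul]
    exact mul_le_mul_of_nonneg_left (mul_le_mul hR0 hR2 (abs_nonneg _) hη0) zero_le_two
  have hA2 : |2 * (moebiusRiesz 1 s ^ 2 - 1)| ≤ 2 * (32 * C₁ / (1 + L) ^ 5 * (2 + 32 * C₁)) := by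
    rw [abs_mul, abs_two]
    exact mul_le_mul_of_nonneg_left hR1sq zero_le_two
  have hB1 : 2 * (η * ((1 + A) * (1 + L))) ≤ (2 * η₀ * (1 + A)) / (1 + L) ^ 2 := by
    have e : 2 * (η * ((1 + A) * (1 + L))) = (2 * η₀ * (1 + A)) / (1 + L) ^ 5 := by
      rw [hηdef, eq_div_iff (by positivity)]
      field_simp
    rw [e]; exact div_pow_le_div_sq (by positivity) hL (by norm_num)
  have hB2 : 2 * (32 * C₁ / (1 + L) ^ 5 * (2 + 32 * C₁)) ≤
      (64 * C₁ * (2 + 32 * C₁)) / (1 + L) ^ 2 := by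
    have e : 2 * (32 * C₁ / (1 + L) ^ 5 * (2 + 32 * C₁)) =
        (64 * C₁ * (2 + 32 * C₁)) / (1 + L) ^ 5 := by ring
    rw [e]; exact div_pow_le_div_sq (by positivity) hL (by norm_num)
  have hsplit : 2 * (moebiusRiesz 0 s * moebiusRiesz 2 s) + 2 * moebiusRiesz 1 s ^ 2 - 2 =
      2 * (moebiusRiesz 0 s * moebiusRiesz 2 s) + 2 * (moebiusRiesz 1 s ^ 2 - 1) := by ring
  rw [hsplit]
  calc |2 * (moebiusRiesz 0 s * moebiusRiesz 2 s) + 2 * (moebiusRiesz 1 s ^ 2 - 1)|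
      ≤ |2 * (moebiusRiesz 0 s * moebiusRiesz 2 s)| + |2 * (moebiusRiesz 1 s ^ 2 - 1)| :=
        abs_add_le _ _
    _ ≤ (2 * η₀ * (1 + A)) / (1 + L) ^ 2 + (64 * C₁ * (2 + 32 * C₁)) / (1 + L) ^ 2 := by linarith
    _ = (2 * η₀ * (1 + A) + 64 * C₁ * (2 + 32 * C₁)) / (1 + L) ^ 2 := by rw [← add_div]

/-- **`R⁽²⁾(z) = 2 + O(1/log² z)`**: the second logarithmic Riesz mean of `(μ ∗ μ)(k)/k` —
`Σ_{de ≤ z} μ(d)μ(e)/(de)·log²(z/(de)) = 2 + O((1 + log z)⁻²)` for all `z ≥ 1` (hyperbola method at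
`√z`: the box is `2R₀R₂ + 2R₁² = 2 + O(log⁻⁵)`, the two tails are `O(log⁻³)` each). The
real-variable form of `res_{s=0} z^s s⁻³ζ(1+s)⁻² = 1`.
[cite: MontgomeryVaughan2007, §8.1 (8.6)–(8.8) — derivation (second Riesz mean of 1/ζ²)] -/
theorem abs_moebiusSqRiesz_sub_two_le :
    ∃ C : ℝ, 0 < C ∧ ∀ z : ℝ, 1 ≤ z →
      |∑ d ∈ Icc 1 ⌊z⌋₊, (μ d : ℝ) / d * moebiusRiesz 2 (z / d) - 2| ≤ C / (1 + Real.log z) ^ 2 := by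
  obtain ⟨C_T, hC_T, hT⟩ := abs_hyperbola_tail_le
  obtain ⟨C_B, hC_B, hB⟩ := abs_hyperbola_box_sub_two_le
  refine ⟨C_B + 2 * C_T, by positivity, fun z hz ↦ ?_⟩
  have hz0 : 0 < z := by linarith
  have hL : 0 ≤ Real.log z := Real.log_nonneg hz
  obtain ⟨-, huu, hZu⟩ := floor_sqrt_facts hz
  set F : ℕ → ℕ → ℝ := fun d e ↦ (μ d : ℝ) / d * ((μ e : ℝ) / e) * Real.log (z / (d * e)) ^ 2
    with hFdef
  have hFsymm : ∀ d e, F d e = F e d := by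
    intro d e; simp only [hFdef]; rw [mul_comm ((μ d : ℝ) / d), mul_comm (d : ℝ)]
  have hR : ∑ d ∈ Icc 1 ⌊z⌋₊, (μ d : ℝ) / d * moebiusRiesz 2 (z / d) =
      ∑ d ∈ Ioc 0 ⌊z⌋₊, ∑ e ∈ Ioc 0 (⌊z⌋₊ / d), F d e :=
    moebiusSqRiesz_eq_sum z
  rw [sum_hyperbola_symm F hFsymm huu hZu, hyperbola_box_eq hz0] at hR
  have hmain : ∑ d ∈ Icc 1 ⌊z⌋₊, (μ d : ℝ) / d * moebiusRiesz 2 (z / d) - 2 =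
      (2 * (moebiusRiesz 0 (Real.sqrt z) * moebiusRiesz 2 (Real.sqrt z)) +
          2 * moebiusRiesz 1 (Real.sqrt z) ^ 2 - 2) +
        2 * ∑ d ∈ Ioc 0 ⌊Real.sqrt z⌋₊, ∑ e ∈ Ioc ⌊Real.sqrt z⌋₊ (⌊z⌋₊ / d), F d e := by
    rw [hR]; ring
  rw [hmain]
  have h1 := hB z hz
  have h2 := hT z hz
  have h2' : |2 * ∑ d ∈ Ioc 0 ⌊Real.sqrt z⌋₊, ∑ e ∈ Ioc ⌊Real.sqrt z⌋₊ (⌊z⌋₊ / d), F d e| ≤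
      2 * (C_T / (1 + Real.log z) ^ 2) := by
    rw [abs_mul, abs_two]
    refine mul_le_mul_of_nonneg_left (h2.trans ?_) zero_le_two
    exact div_pow_le_div_sq hC_T.le hL (by norm_num)
  calc _ ≤ |2 * (moebiusRiesz 0 (Real.sqrt z) * moebiusRiesz 2 (Real.sqrt z)) +
          2 * moebiusRiesz 1 (Real.sqrt z) ^ 2 - 2| +
        |2 * ∑ d ∈ Ioc 0 ⌊Real.sqrt z⌋₊, ∑ e ∈ Ioc ⌊Real.sqrt z⌋₊ (⌊z⌋₊ / d), F d e| :=
        abs_add_le _ _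
    _ ≤ C_B / (1 + Real.log z) ^ 2 + 2 * (C_T / (1 + Real.log z) ^ 2) := add_le_add h1 h2'
    _ = (C_B + 2 * C_T) / (1 + Real.log z) ^ 2 := by ring

end Summit.Parity.GeneralizedHardyLittlewood.Theorems.BeyondDiagonalBeatsQuarter.KernelFormXSq
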